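import Summits.Schanuel.Schanuel.Theorems.RootDecomp1BRadicalDescent05
import Summits.Schanuel.Schanuel.Theorems.RootDecomp1BFactDischarge01

/-!
# RootDecomp1BTwoStorey — lens 4, generation 43 «TWO-PARAMETER RADICAL DESCENT: STOREY THREE AT (1, ρ, σ)» (lane B-R26 (e); CLAIM L2197, ACK/CHECKLIST B-g43 L2199, NODE L2206 / REQUEST L2207, writer re-check L2211, critic VERDICT L2210: CLEARED — ONE CELL (lane (e) «m = 3 storeys»; engine VARIANT-REACH+ of g30, class NEW-LOCAL, territory NEW); RULE B-R29; lens-4 tally THEOREM ×7 + CELL ×4) — part 1 (RootDecomp1BTwoStorey01): §A formal algebra + §B sizes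

(lens-4 g43 HOME kernel K = HOME/decomp-schanuel-lens-4/g43/TwoStorey.lean 24f29895…, 1683 l, imports EXACTLY tree `…RootDecomp1BRadicalDescent05` + `…RootDecomp1BFactDischarge01`; P TwoStoreyProbe.lean da1b0200… rc 0, C TwoStoreyCtrl.lean 1a4b8cdc… rc 1 = exactly the 13 planted errors. Port by census-1 gen 19 as `RootDecomp1BTwoStorey01`–`06` (the verdict's 01–04 along § boundaries, refined for the 400-line cap): 01 = §A formal algebra (norm form `radMatG` of `Σ_k C_k T^{e(k)}` mod `T^q − X_{i₀}` for a general exponent family, `det_radMatG_ne_zero`, `det_eq_eigen_mulG`) + §B sizes (private port copies of RadicalDescent03's private length lemmas; `mvlen_radMatG_le`, `totalDegree_radMatG_le`); 02 = §D-data (`Cf₂`, `Frel₂`, Lipschitz, `eigen_eq_Frel₂`) + §C part 1 (the classes `UltraLiouville₂` / `JU`, `.symm`, `.exists_ge`, `.left/.right` to the tree class `UltraLiouville`, irrationality and `linearIndependent_one_of_algebraicIndependent`, `int_rel_eq_zero`); 03 = §C part 2 (KRONECKER COLLISION `collision_free`, two-dimensional non-vanishing `exists_ball_aeval_ne_zero₂`,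 the typed obstruction `not_dExpMeasure_cons_of_liouville`); 04 = §C part 3 (Baire: `dense_setOf_aeval_ne_zero`, `dense_setOf_ultraLiouville₂_algebraicIndependent`, `exists_pos_pair`, `dense_setOf_JU`; controls `not_JU_sq`, `ultraLiouville₂_zero`, `not_ultraLiouville_zero`); 05 = §D THE KERNEL `algebraicIndependent_radical₂` (two-parameter radical descent; pending a cap edition — one 459-line declaration, census HAND-BACK note); 06 = §E the storey-three cells at `(1, ρ, σ)`, `(ρ, σ) ∈ JU` (`six_le_polarDeg_one_pair`, `kleinPolarSchanuel_body_three_one_pair`, `exists_storey_three_cell`, …; LW by `lwMeasure_holds`).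
PORT EDITS: the two class defs' docstrings tagged «[class] definition …» (census convention, verdict condition); §B's six length lemmas kept as PRIVATE port copies (RadicalDescent03's originals are private); statements and proofs verbatim; no linter option in K; the one scoped `maxHeartbeats 1600000` sits on the §D kernel (part 05). `--supports stmt-Schanuel-24622`; no census credit carried; rung 0 — nothing here proves Schanuel; items 24622 / 32406–08 stay OPEN.)
-/

/-!
# RootDecomp1BTwoStorey — lens 4, generation 43 «TWO-PARAMETER RADICAL DESCENT: STOREY THREE AT (1, ρ, σ)»

Unit `decomp-schanuel-lens-4-g43` · 2026-08-31 · HOME `decomp-schanuel-lens-4/g43/TwoStorey.lean`.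
RUNG 0: nothing in this file proves Schanuel's conjecture or the crux `KleinPolarSchanuel`; route-Schanuel-RootDecomp1B
(DRAFT rev 32) is UNCHANGED (no item / split / kind / closes / residual change; no ledger write).

NODE OF RECORD.  `_root_.Schanuel` ⟸ X = `Summit.Schanuel.Schanuel.Theses.RootDecomp1B.KleinPolarSchanuel`
(stmt-Schanuel-24622: `∀ m (r : Fin m → ℝ), LinearIndependent ℚ r → m + m ≤ t(r)`, `t(r) = polarDeg r`).

WHAT THIS FILE DECIDES (hypothesis-free: the Lindemann–Weierstrass measure is the tree theorem `lwMeasure_holds`):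

* §E  **STOREY THREE: X(3) AT (1, ρ, σ)** — `t(1, ρ, σ) ≥ 6 = m + m` (`m = 3`) for EVERY pair `(ρ, σ)` of positive,
  JOINTLY ultra-Liouville (common denominators, §C) and algebraically independent reals; the class is a dense `G_δ`-type
  (comeagre) subset of `ℝ²`, non-empty by Baire (§C, hypothesis-free).  The first cells of route 1B with TWO transcendental
  coordinates over an algebraic one; `(1, ρ)` and `(1, σ)` are storey-two cells of `RootDecomp1BRadicalDescent05`.
* §D  **KERNEL (two-parameter radical descent)** `algebraicIndependent_radical₂`: `DExpMeasure θ`, `e^{y₀} = θ_{i₀}`,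
  `(ρ, σ)` positive jointly ultra-Liouville algebraically independent ⟹ `(e^{ρ y₀}, e^{σ y₀}, ρ, σ, θ)` algebraically
  independent.  §A: the norm form of `Σ_k C_k T^{e(k)}` modulo `T^q − X_{i₀}` for an ARBITRARY finite exponent family
  (`radMatG`, `det_radMatG_ne_zero`, `det_eq_eigen_mulG`), §B its sizes, §C the class, the Kronecker collision lemma and
  the typed obstruction `not_dExpMeasure_cons_of_liouville` (why the one-parameter kernel cannot be iterated).
-/

noncomputable section

open Complex

namespace Summit.Schanuel.Schanuel.Theorems.RootDecomp1BTwoStorey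

open Summit.Schanuel.Schanuel.Theorems.RootDecomp1BRadicalDescent (resFin resFin_val powSubst powSubst_X_self
  powSubst_eq_zero_iff QDiv qdiv_powSubst residue_lemma)

/-! ## §A  FORMAL ALGEBRA: the norm form of `Σ_k C_k T^{e(k)}` modulo `T^q − X_{i₀}`, general exponent family -/

section Formal

open MvPolynomial

variable {n : ℕ}

/-- **The fibre sum (general exponents).** If `w ^ q = t` then the matrix of multiplication by `Σ_{k ∈ S} c_k T^{e k}`
modulo `T^q − t` (row `l`, column `a`, entries `Σ_{(e k + l) % q = a} c_k t^{(e k + l)/q}`) has `(w^a)_a` as an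
eigenvector with eigenvalue `Σ_k c_k w^{e k}`. -/
theorem fiber_sumG {R : Type*} [CommSemiring R] {ι : Type*} {q : ℕ} (hq : 0 < q) (S : Finset ι) (e : ι → ℕ)
    (c : ι → R) (t w : R) (hw : w ^ q = t) (l : Fin q) :
    ∑ a : Fin q, (∑ k ∈ S.filter (fun k => resFin hq (e k + l) = a), c k * t ^ ((e k + l) / q)) * w ^ (a : ℕ) =
      (∑ k ∈ S, c k * w ^ (e k)) * w ^ (l : ℕ) := by
  classical
  have step1 : ∀ a : Fin q,
      (∑ k ∈ S.filter (fun k => resFin hq (e k + l) = a), c k * t ^ ((e k + l) / q)) * w ^ (a : ℕ) =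
      ∑ k ∈ S.filter (fun k => resFin hq (e k + l) = a), c k * w ^ (e k + l) := by
    intro a
    rw [Finset.sum_mul]
    refine Finset.sum_congr rfl fun k hk => ?_
    have hka : resFin hq (e k + l) = a := (Finset.mem_filter.1 hk).2
    have hav : (a : ℕ) = (e k + l) % q := by rw [← hka]; rfl
    rw [← hw, ← pow_mul, mul_assoc, ← pow_add, hav, Nat.div_add_mod]
  rw [Finset.sum_congr rfl fun a _ => step1 a,
    Finset.sum_fiberwise_of_maps_to (fun k _ => Finset.mem_univ _), Finset.sum_mul]
  refine Finset.sum_congr rfl fun k _ => ?_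
  rw [pow_add, mul_assoc]

variable (i₀ : Fin n) (q : ℕ)

/-- **The norm-form matrix (general exponents).** Row `l`, column `a`:
`Σ_{k ∈ S, (e k + l) % q = a} C_k · X_{i₀}^{(e k + l)/q}` — multiplication by `Σ_k C_k T^{e k}` on
`ℤ[X][T]/(T^q − X_{i₀})` in the basis `T^l`. -/
def radMatG {ι : Type*} (S : Finset ι) (Cf : ι → MvPolynomial (Fin n) ℤ) (e : ι → ℕ) {q : ℕ} (hq : 0 < q)
    (i₀ : Fin n) : Matrix (Fin q) (Fin q) (MvPolynomial (Fin n) ℤ) :=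
  fun l a => ∑ k ∈ S.filter (fun k => resFin hq (e k + l) = a), Cf k * X i₀ ^ ((e k + l) / q)

/-- `powSubst` applied to an entry of `radMatG`. -/
theorem powSubst_radMatG {ι : Type*} (S : Finset ι) (Cf : ι → MvPolynomial (Fin n) ℤ) (e : ι → ℕ)
    (hq : 0 < q) (l a : Fin q) :
    powSubst i₀ q (radMatG S Cf e hq i₀ l a) =
      ∑ k ∈ S.filter (fun k => resFin hq (e k + l) = a), powSubst i₀ q (Cf k) * (X i₀ ^ q) ^ ((e k + l) / q) := by
  classical
  simp only [radMatG, map_sum, map_mul, map_pow, powSubst_X_self]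

/-- **Formal non-vanishing of the general norm form.** If the exponents `e k` (`k ∈ S`) are pairwise distinct
modulo `q` and some `C_k ≠ 0`, then `det (radMatG) ≠ 0` in `ℤ[X]`. -/
theorem det_radMatG_ne_zero {ι : Type*} (S : Finset ι) (Cf : ι → MvPolynomial (Fin n) ℤ) (e : ι → ℕ)
    (hq : 0 < q) (he : ∀ k ∈ S, ∀ k' ∈ S, e k % q = e k' % q → k = k') (hC : ∃ k ∈ S, Cf k ≠ 0) :
    (radMatG S Cf e hq i₀).det ≠ 0 := by
  classical
  rw [Ne, ← Matrix.exists_vecMul_eq_zero_iff]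
  rintro ⟨v, hv0, hv⟩
  apply hv0
  set Ψ : MvPolynomial (Fin n) ℤ := ∑ k ∈ S, powSubst i₀ q (Cf k) * X i₀ ^ (e k) with hΨ
  set V : MvPolynomial (Fin n) ℤ := ∑ l : Fin q, powSubst i₀ q (v l) * X i₀ ^ (l : ℕ) with hV
  have hrow : ∀ l : Fin q,
      ∑ a : Fin q, powSubst i₀ q (radMatG S Cf e hq i₀ l a) * X i₀ ^ (a : ℕ) = Ψ * X i₀ ^ (l : ℕ) := by
    intro l
    simp_rw [powSubst_radMatG]
    exact fiber_sumG hq S e (fun k => powSubst i₀ q (Cf k)) (X i₀ ^ q) (X i₀) rfl l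
  have h1 : ∀ a : Fin q, powSubst i₀ q ((Matrix.vecMul v (radMatG S Cf e hq i₀)) a) = 0 := fun a => by
    rw [hv]; simp
  have hVΨ : V * Ψ = 0 := by
    calc V * Ψ = ∑ l : Fin q, powSubst i₀ q (v l) * (Ψ * X i₀ ^ (l : ℕ)) := by
          rw [hV, Finset.sum_mul]
          exact Finset.sum_congr rfl fun l _ => by ring
      _ = ∑ l : Fin q, powSubst i₀ q (v l) *
            ∑ a : Fin q, powSubst i₀ q (radMatG S Cf e hq i₀ l a) * X i₀ ^ (a : ℕ) := by
          simp_rw [hrow]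
      _ = ∑ a : Fin q, powSubst i₀ q ((Matrix.vecMul v (radMatG S Cf e hq i₀)) a) * X i₀ ^ (a : ℕ) := by
          simp only [Matrix.vecMul, dotProduct, map_sum, map_mul, Finset.mul_sum, Finset.sum_mul]
          rw [Finset.sum_comm]
          exact Finset.sum_congr rfl fun a _ => Finset.sum_congr rfl fun l _ => by ring
      _ = 0 := by simp [h1]
  have hΨ0 : Ψ ≠ 0 := by
    intro hΨz
    obtain ⟨k₀, hk₀, hCk₀⟩ := hC
    have hres := residue_lemma i₀ q hq S (fun k => powSubst i₀ q (Cf k)) e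
      (fun k _ => qdiv_powSubst i₀ q (Cf k)) he hΨz k₀ hk₀
    exact hCk₀ ((powSubst_eq_zero_iff i₀ q hq _).1 hres)
  have hV0 : V = 0 := (mul_eq_zero.1 hVΨ).resolve_right hΨ0
  have hres := residue_lemma i₀ q hq (Finset.univ : Finset (Fin q)) (fun l => powSubst i₀ q (v l))
    (fun l => (l : ℕ)) (fun l _ => qdiv_powSubst i₀ q (v l)) ?_ hV0
  · funext l
    exact (powSubst_eq_zero_iff i₀ q hq _).1 (hres l (Finset.mem_univ l))
  · intro l _ l' _ hll
    rw [Nat.mod_eq_of_lt l.isLt, Nat.mod_eq_of_lt l'.isLt] at hll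
    exact Fin.ext hll

/-- **Norm factorisation (evaluated, general exponents).** If `w^q = t` and `Mθ` is the evaluated norm-form matrix,
then `det Mθ = (Σ_k c_k w^{e k}) · Σ_a adj(Mθ)_{0a} w^a`. -/
theorem det_eq_eigen_mulG {ι : Type*} {q : ℕ} (hq : 0 < q) (S : Finset ι) (e : ι → ℕ) (c : ι → ℂ) (t w : ℂ)
    (hw : w ^ q = t) (Mθ : Matrix (Fin q) (Fin q) ℂ)
    (hM : ∀ l a, Mθ l a = ∑ k ∈ S.filter (fun k => resFin hq (e k + l) = a), c k * t ^ ((e k + l) / q)) :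
    Mθ.det = (∑ k ∈ S, c k * w ^ (e k)) * ∑ a : Fin q, Mθ.adjugate ⟨0, hq⟩ a * w ^ (a : ℕ) := by
  classical
  set vw : Fin q → ℂ := fun a => w ^ (a : ℕ) with hvw
  set Φ : ℂ := ∑ k ∈ S, c k * w ^ (e k) with hΦ
  have heig : Mθ.mulVec vw = Φ • vw := by
    funext l
    simp only [Matrix.mulVec, dotProduct, Pi.smul_apply, smul_eq_mul, hvw]
    rw [Finset.sum_congr rfl fun a _ => by rw [hM l a], fiber_sumG hq S e c t w hw l]
  have h2 : Mθ.adjugate.mulVec (Mθ.mulVec vw) = Mθ.det • vw := by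
    rw [Matrix.mulVec_mulVec, Matrix.adjugate_mul, Matrix.smul_mulVec, Matrix.one_mulVec]
  have h3 : Mθ.det • vw = Φ • (Mθ.adjugate.mulVec vw) := by
    rw [← h2, heig, Matrix.mulVec_smul]
  have h4 := congrFun h3 ⟨0, hq⟩
  simp only [Pi.smul_apply, smul_eq_mul, Matrix.mulVec, dotProduct, hvw, pow_zero, mul_one] at h4
  rw [h4]

end Formal

/-! ## §B  SIZES: private port copies of the length lemmas; entry bounds for `radMatG` -/

section PortCopies
open MvPolynomial
open Summit.Schanuel.Schanuel.Theorems.RootDecomp1KHyper (mvlen mvlen_nonneg mvlen_eq_sum_of_support_subset)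
variable {n : ℕ}

/-- The length of a monomial `c · x^m` is at most `|c|`. -/
private theorem mvlen_monomial_le (m : Fin n →₀ ℕ) (c : ℤ) : mvlen (monomial m c) ≤ |c| := by
  classical
  rw [mvlen_eq_sum_of_support_subset _ support_monomial_subset, Finset.sum_singleton, coeff_monomial,
    if_pos rfl]

/-- The length of the zero polynomial is `0`. -/
private theorem mvlen_zero : mvlen (0 : MvPolynomial (Fin n) ℤ) = 0 := by simp [mvlen]

/-- Subadditivity of the length. -/
private theorem mvlen_add_le (P Q : MvPolynomial (Fin n) ℤ) : mvlen (P + Q) ≤ mvlen P + mvlen Q := by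
  classical
  rw [mvlen_eq_sum_of_support_subset _ support_add,
    mvlen_eq_sum_of_support_subset P (Finset.subset_union_left (s₂ := Q.support)),
    mvlen_eq_sum_of_support_subset Q (Finset.subset_union_right (s₁ := P.support)),
    ← Finset.sum_add_distrib]
  exact Finset.sum_le_sum fun m _ => by rw [coeff_add]; exact abs_add_le _ _

/-- The length of a finite sum is at most the sum of the lengths. -/
private theorem mvlen_sum_le {ι : Type*} (s : Finset ι) (f : ι → MvPolynomial (Fin n) ℤ) :
    mvlen (∑ i ∈ s, f i) ≤ ∑ i ∈ s, mvlen (f i) := by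
  classical
  induction s using Finset.induction_on with
  | empty => simp [mvlen_zero]
  | insert a s ha ih =>
    rw [Finset.sum_insert ha, Finset.sum_insert ha]
    exact (mvlen_add_le _ _).trans (by linarith)

/-- `mvlen (P · c x^a) ≤ mvlen P · |c|`. -/
private theorem mvlen_mul_monomial_le (P : MvPolynomial (Fin n) ℤ) (a : Fin n →₀ ℕ) (b : ℤ) :
    mvlen (P * monomial a b) ≤ mvlen P * |b| := by
  classical
  have hP : P * monomial a b = ∑ m ∈ P.support, monomial (m + a) (P.coeff m * b) := by
    conv_lhs => rw [P.as_sum]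
    rw [Finset.sum_mul]
    exact Finset.sum_congr rfl fun m _ => monomial_mul
  rw [hP]
  calc mvlen (∑ m ∈ P.support, monomial (m + a) (P.coeff m * b))
      ≤ ∑ m ∈ P.support, mvlen (monomial (m + a) (P.coeff m * b)) := mvlen_sum_le _ _
    _ ≤ ∑ m ∈ P.support, |P.coeff m| * |b| :=
        Finset.sum_le_sum fun m _ => (mvlen_monomial_le _ _).trans_eq (abs_mul _ _)
    _ = mvlen P * |b| := by rw [← Finset.sum_mul]; rfl

/-- Multiplying by a power of a variable does not increase the length. -/
private theorem mvlen_mul_X_pow_le (P : MvPolynomial (Fin n) ℤ) (i : Fin n) (e : ℕ) :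
    mvlen (P * X i ^ e) ≤ mvlen P := by
  rw [X_pow_eq_monomial]
  simpa using mvlen_mul_monomial_le P (Finsupp.single i e) 1

end PortCopies

section SizesG
open MvPolynomial
open Summit.Schanuel.Schanuel.Theorems.RootDecomp1KHyper (mvlen mvlen_nonneg)
variable {n : ℕ}

/-- Entry length bound for the general norm-form matrix: `mvlen (radMatG)_{l a} ≤ #S · E₁` if every `mvlen C_k ≤ E₁`. -/
theorem mvlen_radMatG_le {ι : Type*} (S : Finset ι) (Cf : ι → MvPolynomial (Fin n) ℤ) (e : ι → ℕ) {q : ℕ}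
    (hq : 0 < q) (i₀ : Fin n) {E₁ : ℤ} (hE : ∀ k ∈ S, mvlen (Cf k) ≤ E₁) (hE0 : 0 ≤ E₁) (l a : Fin q) :
    mvlen (radMatG S Cf e hq i₀ l a) ≤ (S.card : ℤ) * E₁ := by
  classical
  unfold radMatG
  calc mvlen (∑ k ∈ S.filter (fun k => resFin hq (e k + l) = a), Cf k * X i₀ ^ ((e k + l) / q))
      ≤ ∑ k ∈ S.filter (fun k => resFin hq (e k + l) = a), mvlen (Cf k * X i₀ ^ ((e k + l) / q)) :=
        mvlen_sum_le _ _
    _ ≤ ∑ k ∈ S.filter (fun k => resFin hq (e k + l) = a), E₁ :=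
        Finset.sum_le_sum fun k hk => (mvlen_mul_X_pow_le _ _ _).trans (hE k (Finset.mem_filter.1 hk).1)
    _ ≤ ∑ _k ∈ S, E₁ := Finset.sum_le_sum_of_subset_of_nonneg (Finset.filter_subset _ _) (fun _ _ _ => hE0)
    _ = (S.card : ℤ) * E₁ := by simp

/-- Entry degree bound for the general norm-form matrix: `deg (radMatG)_{l a} ≤ d + D` when every `deg C_k ≤ d` and
every exponent `e k ≤ q · D`. -/
theorem totalDegree_radMatG_le {ι : Type*} (S : Finset ι) (Cf : ι → MvPolynomial (Fin n) ℤ) (e : ι → ℕ)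
    {q : ℕ} (hq : 0 < q) (i₀ : Fin n) {d D : ℕ} (hd : ∀ k ∈ S, (Cf k).totalDegree ≤ d)
    (hD : ∀ k ∈ S, e k ≤ q * D) (l a : Fin q) :
    (radMatG S Cf e hq i₀ l a).totalDegree ≤ d + D := by
  classical
  unfold radMatG
  refine totalDegree_finsetSum_le fun k hk => ?_
  have hkS : k ∈ S := (Finset.mem_filter.1 hk).1
  refine (totalDegree_mul _ _).trans (add_le_add (hd k hkS) ?_)
  rw [totalDegree_X_pow]
  calc (e k + l) / q ≤ (q * D + l) / q := Nat.div_le_div_right (by linarith [hD k hkS])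
    _ = D + l / q := by rw [Nat.mul_add_div hq]
    _ = D := by rw [Nat.div_eq_of_lt l.isLt, add_zero]

end SizesG

end Summit.Schanuel.Schanuel.Theorems.RootDecomp1BTwoStorey

end
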